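import Summits.ValiantsHypothesis.ValiantsHypothesis.Theorems.SymPencilPerFourPeeledTwoPencilChordA
import Summits.ValiantsHypothesis.ValiantsHypothesis.Theorems.SymPencilPerFourPeeledTwoPencilCaseAQ

/-!
# Route `SymPencil` — inner rank of the `2 | 2` row split of `per_4`, PEELED case: `Q ≠ 0` for the
# CHORD PENCIL in `V_r` and the complete S2 chart (`--supports` stmt-ValiantsHypothesis-5674
# `SdcSuperquadratic`; (8,8) column, memo `NOTE-p8g15-5674-R2-two-pencil.md` §9.3–§9.5; rung
# currency only)

`…TwoPencilChordA.frames_of_chordA` kept `Q ≠ 0` as a hypothesis.  As for Case A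
(`…TwoPencilCaseAQ`), `Q = P₁₁ − P₁₀W₀P₀₁` is linear in `a₁`, vanishes at `a₁ = a₀`, and row `3` of
`det 𝐇(z₀)·a₀₃a₀ₗ·Q₃ₗ` is `12r³(3r+4)² · Σ_k c̃_{lk} ξ̂_k` (`ξ̂_k = a₁ₖ Π_{m≠k} a₀ₘ`) with the
Klein-symmetric pattern `c̃ = [[0,−A,B,−C],[−A,0,−C,B],[B,−C,0,−A],[−C,B,−A,0]]`,
`A = (r−3)(r+1)`, `B = r²−3 = A + C`, `C = 2r` (kit j321795, exact), whose kernel is `K·𝟙` as soon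
as `ABC ≠ 0`.  Hence (`chordA_Q_ne_zero`) `Q ≠ 0` for `a₁ ∉ K a₀` when moreover `r ≠ 3`, `r² ≠ 3`,
and (★ `frames_of_chordA_of_indep`) the S2 chart of the coverage programme needs only the incidences
and `a₁ ∉ K a₀`.

Honest framing: atlas chart; no cell closes here; the window `28 ≤ sdc(per₄) ≤ 29` of record, the
crux `SdcSuperquadratic` and `VP ≠ VNP` are untouched.  No definitions, no named facts. [folklore]
-/

noncomputable section

-- single-conjunct layout: Sub = Summit, duplicated namespace component intended
set_option linter.dupNamespace false

namespace Summit.ValiantsHypothesis.ValiantsHypothesis.Theorems.SymPencilPerFourPeeledTwoPencilChordAQ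

open Matrix Finset Module
open Summit.ValiantsHypothesis.ValiantsHypothesis.Theorems.SymPencilPerFourPeeledTwoPencilSigmaZero
open Summit.ValiantsHypothesis.ValiantsHypothesis.Theorems.SymPencilPerFourPeeledTwoPencilTransport
open Summit.ValiantsHypothesis.ValiantsHypothesis.Theorems.SymPencilPerFourPeeledTwoPencilCaseAQ
open Summit.ValiantsHypothesis.ValiantsHypothesis.Theorems.SymPencilPerFourPeeledTwoPencilChordA

universe u

variable {K : Type u} [Field K]

/-- The adjugate of `𝐇(z₀)`, `z₀ = (3r²+4r, 3r+4, −3r, r²)`. [folklore] -/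
theorem chordA_adj (r : K) :
    (!![72*r^6 + 264*r^5 + 344*r^4 + 184*r^3 + 32*r^2, -36*r^5 - 228*r^4 - 480*r^3 - 416*r^2 - 128*r, 36*r^5 + 60*r^4 + 16*r^3, -24*r^6 - 56*r^5 + 40*r^4 + 168*r^3 + 96*r^2; -36*r^5 - 228*r^4 - 480*r^3 - 416*r^2 - 128*r, 24*r^4 + 128*r^3 + 296*r^2 + 320*r + 128, -24*r^4 - 32*r^3 + 72*r^2 + 96*r, 12*r^5 + 52*r^4 + 96*r^3 + 64*r^2; 36*r^5 + 60*r^4 + 16*r^3, -24*r^4 - 32*r^3 + 72*r^2 + 96*r, 24*r^4 - 64*r^3 - 24*r^2, -12*r^5 - 12*r^4 + 112*r^3 + 96*r^2; -24*r^6 - 56*r^5 + 40*r^4 + 168*r^3 + 96*r^2, 12*r^5 + 52*r^4 + 96*r^3 + 64*r^2, -12*r^5 - 12*r^4 + 112*r^3 + 96*r^2, 8*r^6 + 8*r^5 - 40*r^4 - 136*r^3 - 96*r^2] : Matrix (Fin 4) (Fin 4) K) * (!![0, r^2 - 3*r, r^2 + 3*r + 4, 4;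
      r^2 - 3*r, 0, 4*r^2 + 4*r, 3*r^2 + r;
      r^2 + 3*r + 4, 4*r^2 + 4*r, 0, 3*r^2 + 7*r + 4;
      4, 3*r^2 + r, 3*r^2 + 7*r + 4, 0] : Matrix (Fin 4) (Fin 4) K) =
      (-16 * r ^ 2 * (3 * r + 4) * (r ^ 3 - 8 * r ^ 2 - 20 * r - 12)) • (1 : Matrix (Fin 4) (Fin 4) K) := by
  ext i j
  fin_cases i <;> fin_cases j <;> simp [Matrix.mul_apply, Fin.sum_univ_four] <;> ring

/-- **`Q ≠ 0` for the chord frames**, given `a₀` with non-zero coordinates and `a₁ ∉ K a₀`.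
[folklore] -/
theorem chordA_Q_ne_zero [CharZero K] (a₀ a₁ : Fin 4 → K) (ha : ∀ k, a₀ k ≠ 0)
    (hind : ∀ μ : K, a₁ ≠ μ • a₀) (r : K) (hr : r ≠ 0) (h1 : r + 1 ≠ 0) (h34 : 3 * r + 4 ≠ 0)
    (hcub : r ^ 3 - 8 * r ^ 2 - 20 * r - 12 ≠ 0) (h3 : r - 3 ≠ 0) (hsq3 : r ^ 2 - 3 ≠ 0) :
    (Matrix.of fun b l : Fin 4 =>
          (Matrix.of ![a₁, Pi.single b (1 : K), (fun k => a₀ k * (![r, 1, 0, -r - 1] : Fin 4 → K) k), Pi.single l 1]).permanent) -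
        (Matrix.of fun b l : Fin 4 =>
          (Matrix.of ![a₀, Pi.single b (1 : K), (fun k => a₀ k * (![r, 1, 0, -r - 1] : Fin 4 → K) k), Pi.single l 1]).permanent) *
        ((a₀ 0 * a₀ 1 * a₀ 2 * a₀ 3)⁻¹ •
          (Matrix.diagonal a₀ * ((!![0, r^2 - 3*r, r^2 + 3*r + 4, 4;
      r^2 - 3*r, 0, 4*r^2 + 4*r, 3*r^2 + r;
      r^2 + 3*r + 4, 4*r^2 + 4*r, 0, 3*r^2 + 7*r + 4;
      4, 3*r^2 + r, 3*r^2 + 7*r + 4, 0] : Matrix (Fin 4) (Fin 4) K))⁻¹ * Matrix.diagonal a₀)) *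
        (Matrix.of fun b l : Fin 4 =>
          (Matrix.of ![a₁, Pi.single b (1 : K), (fun k => a₀ k * (![3*r^2 + 4*r, 3*r + 4, -3*r, r^2] : Fin 4 → K) k), Pi.single l 1]).permanent)
        ≠ 0 := by
  intro hQ0
  let z₀ : Fin 4 → K := ![3*r^2 + 4*r, 3*r + 4, -3*r, r^2]
  let z₁ : Fin 4 → K := ![r, 1, 0, -r - 1]
  let P₁₁ : Matrix (Fin 4) (Fin 4) K := Matrix.of fun b l : Fin 4 =>
    (Matrix.of ![a₁, Pi.single b (1 : K), (fun k => a₀ k * z₁ k), Pi.single l 1]).permanent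
  let P₁₀ : Matrix (Fin 4) (Fin 4) K := Matrix.of fun b l : Fin 4 =>
    (Matrix.of ![a₀, Pi.single b (1 : K), (fun k => a₀ k * z₁ k), Pi.single l 1]).permanent
  let P₀₁ : Matrix (Fin 4) (Fin 4) K := Matrix.of fun b l : Fin 4 =>
    (Matrix.of ![a₁, Pi.single b (1 : K), (fun k => a₀ k * z₀ k), Pi.single l 1]).permanent
  set pa : K := a₀ 0 * a₀ 1 * a₀ 2 * a₀ 3 with hpa
  have hpa0 : pa ≠ 0 := by
    rw [hpa]; exact mul_ne_zero (mul_ne_zero (mul_ne_zero (ha 0) (ha 1)) (ha 2)) (ha 3)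
  let D : Matrix (Fin 4) (Fin 4) K := Matrix.diagonal a₀
  let Di : Matrix (Fin 4) (Fin 4) K := Matrix.diagonal fun k => (a₀ k)⁻¹
  have hDiD : Di * D = 1 := by
    rw [Matrix.diagonal_mul_diagonal, ← Matrix.diagonal_one]
    congr 1; funext k; exact inv_mul_cancel₀ (ha k)
  have hc2 : ∀ X : Matrix (Fin 4) (Fin 4) K, Di * (D * X) = X := fun X => by
    rw [← Matrix.mul_assoc, hDiD, Matrix.one_mul]
  set dt : K := -16 * r ^ 2 * (3 * r + 4) * (r ^ 3 - 8 * r ^ 2 - 20 * r - 12) with hdt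
  have hdt0 : dt ≠ 0 := by
    rw [hdt]
    have h16 : (-16 : K) ≠ 0 := by norm_num
    exact mul_ne_zero (mul_ne_zero (mul_ne_zero h16 (pow_ne_zero 2 hr)) h34) hcub
  let H₀ : Matrix (Fin 4) (Fin 4) K := !![0, r^2 - 3*r, r^2 + 3*r + 4, 4;
      r^2 - 3*r, 0, 4*r^2 + 4*r, 3*r^2 + r;
      r^2 + 3*r + 4, 4*r^2 + 4*r, 0, 3*r^2 + 7*r + 4;
      4, 3*r^2 + r, 3*r^2 + 7*r + 4, 0]
  let ADJ : Matrix (Fin 4) (Fin 4) K := !![72*r^6 + 264*r^5 + 344*r^4 + 184*r^3 + 32*r^2, -36*r^5 - 228*r^4 - 480*r^3 - 416*r^2 - 128*r, 36*r^5 + 60*r^4 + 16*r^3, -24*r^6 - 56*r^5 + 40*r^4 + 168*r^3 + 96*r^2; -36*r^5 - 228*r^4 - 480*r^3 - 416*r^2 - 128*r, 24*r^4 + 128*r^3 + 296*r^2 + 320*r + 128, -24*r^4 - 32*r^3 + 72*r^2 + 96*r, 12*r^5 + 52*r^4 + 96*r^3 + 64*r^2; 36*r^5 + 60*r^4 + 16*r^3,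 -24*r^4 - 32*r^3 + 72*r^2 + 96*r, 24*r^4 - 64*r^3 - 24*r^2, -12*r^5 - 12*r^4 + 112*r^3 + 96*r^2; -24*r^6 - 56*r^5 + 40*r^4 + 168*r^3 + 96*r^2, 12*r^5 + 52*r^4 + 96*r^3 + 64*r^2, -12*r^5 - 12*r^4 + 112*r^3 + 96*r^2, 8*r^6 + 8*r^5 - 40*r^4 - 136*r^3 - 96*r^2]
  have hadj : ADJ * H₀ = dt • (1 : Matrix (Fin 4) (Fin 4) K) := chordA_adj r
  have hinv : H₀⁻¹ = dt⁻¹ • ADJ := by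
    refine Matrix.inv_eq_left_inv ?_
    rw [Matrix.smul_mul, hadj, smul_smul, inv_mul_cancel₀ hdt0, one_smul]
  -- the second Hessian and the transport of `P₁₀`
  let H₁ : Matrix (Fin 4) (Fin 4) K := Matrix.of fun b l : Fin 4 =>
    if b = l then (0 : K) else (z₁ 0 + z₁ 1 + z₁ 2 + z₁ 3) - z₁ b - z₁ l
  have T1 : P₁₀ = pa • (Di * H₁ * Di) := transport_hess a₀ z₁ ha H₁ (fun b l => rfl)
  have hPW : P₁₀ * ((a₀ 0 * a₀ 1 * a₀ 2 * a₀ 3)⁻¹ • (Matrix.diagonal a₀ * H₀⁻¹ * Matrix.diagonal a₀)) =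
      dt⁻¹ • (Di * (H₁ * (ADJ * D))) := by
    rw [T1, hinv, ← hpa]
    show (pa • (Di * H₁ * Di)) * (pa⁻¹ • (D * (dt⁻¹ • ADJ) * D)) = dt⁻¹ • (Di * (H₁ * (ADJ * D)))
    simp only [Matrix.smul_mul, Matrix.mul_smul, smul_smul, Matrix.mul_assoc, hc2]
    have hsc : pa⁻¹ * dt⁻¹ * pa = dt⁻¹ := by field_simp
    rw [hsc]
  -- row `3` of `H₁ · ADJ`, and the explicit permanent entries
  have hrow : ∀ m : Fin 4, (Di * (H₁ * (ADJ * D))) 3 m =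
      (a₀ 3)⁻¹ * ((ADJ 0 m + r * ADJ 1 m + (r + 1) * ADJ 2 m) * a₀ m) := by
    intro m
    rw [Matrix.diagonal_mul, Matrix.mul_apply]
    simp only [D, Fin.sum_univ_four, Matrix.mul_diagonal]
    have r0 : H₁ 3 0 = 1 := by simp [H₁, z₁]
    have r1 : H₁ 3 1 = r := by simp [H₁, z₁]
    have r2 : H₁ 3 2 = r + 1 := by simp [H₁, z₁]; ring
    have r3 : H₁ 3 3 = 0 := by simp [H₁]
    rw [r0, r1, r2, r3]; ring
  have hP01 : P₀₁ = !![0, (r^2) * a₀ 3 * a₁ 2 + (-3*r) * a₀ 2 * a₁ 3, (r^2) * a₀ 3 * a₁ 1 + (3*r + 4) * a₀ 1 * a₁ 3, (-3*r) * a₀ 2 * a₁ 1 + (3*r + 4) * a₀ 1 * a₁ 2;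
      (r^2) * a₀ 3 * a₁ 2 + (-3*r) * a₀ 2 * a₁ 3, 0, (r^2) * a₀ 3 * a₁ 0 + (3*r^2 + 4*r) * a₀ 0 * a₁ 3, (-3*r) * a₀ 2 * a₁ 0 + (3*r^2 + 4*r) * a₀ 0 * a₁ 2;
      (r^2) * a₀ 3 * a₁ 1 + (3*r + 4) * a₀ 1 * a₁ 3, (r^2) * a₀ 3 * a₁ 0 + (3*r^2 + 4*r) * a₀ 0 * a₁ 3, 0, (3*r + 4) * a₀ 1 * a₁ 0 + (3*r^2 + 4*r) * a₀ 0 * a₁ 1;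
      (-3*r) * a₀ 2 * a₁ 1 + (3*r + 4) * a₀ 1 * a₁ 2, (-3*r) * a₀ 2 * a₁ 0 + (3*r^2 + 4*r) * a₀ 0 * a₁ 2, (3*r + 4) * a₀ 1 * a₁ 0 + (3*r^2 + 4*r) * a₀ 0 * a₁ 1, 0] := by
    ext m l
    simp only [P₀₁, z₀, Matrix.of_apply]
    rw [per_single_mixed]
    fin_cases m <;> fin_cases l <;> simp [Fin.sum_univ_four] <;> ring
  have hP11 : ∀ l : Fin 4, P₁₁ 3 l = (![(0) * a₀ 2 * a₁ 1 + (1) * a₀ 1 * a₁ 2, (0) * a₀ 2 * a₁ 0 + (r) * a₀ 0 * a₁ 2, (1) * a₀ 1 * a₁ 0 + (r) * a₀ 0 * a₁ 1, 0] : Fin 4 → K) l := by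
    intro l
    simp only [P₁₁, z₁, Matrix.of_apply]
    rw [per_single_mixed]
    fin_cases l <;> simp [Fin.sum_univ_four] <;> ring
  -- the three entries `Q 3 l`, `l = 1, 2, 3`
  have E : ∀ l : Fin 4, P₁₁ 3 l - ∑ m : Fin 4, (dt⁻¹ • (Di * (H₁ * (ADJ * D)))) 3 m * P₀₁ m l = 0 := by
    intro l
    have := congr_fun (congr_fun hQ0 3) l
    rw [Matrix.zero_apply, Matrix.sub_apply, Matrix.mul_apply, hPW] at this
    exact this
  have ha0 := ha 0; have ha1 := ha 1; have ha2 := ha 2; have ha3 := ha 3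
  have step : ∀ l : Fin 4,
      (P₁₁ 3 l - ∑ m : Fin 4, (dt⁻¹ • (Di * (H₁ * (ADJ * D)))) 3 m * P₀₁ m l) * (dt * a₀ 3 * a₀ l) =
      P₁₁ 3 l * dt * a₀ 3 * a₀ l -
        ∑ m : Fin 4, (ADJ 0 m + r * ADJ 1 m + (r + 1) * ADJ 2 m) * a₀ m * a₀ l * P₀₁ m l := by
    intro l
    simp only [Matrix.smul_apply, smul_eq_mul, hrow, Finset.sum_mul, sub_mul]
    congr 1
    · ring
    · refine Finset.sum_congr rfl fun m _ => ?_
      field_simp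
  -- explicit adjugate entries
  have hA00 : ADJ 0 0 = 72*r^6 + 264*r^5 + 344*r^4 + 184*r^3 + 32*r^2 := rfl
  have hA01 : ADJ 0 1 = -36*r^5 - 228*r^4 - 480*r^3 - 416*r^2 - 128*r := rfl
  have hA02 : ADJ 0 2 = 36*r^5 + 60*r^4 + 16*r^3 := rfl
  have hA03 : ADJ 0 3 = -24*r^6 - 56*r^5 + 40*r^4 + 168*r^3 + 96*r^2 := rfl
  have hA10 : ADJ 1 0 = -36*r^5 - 228*r^4 - 480*r^3 - 416*r^2 - 128*r := rfl
  have hA11 : ADJ 1 1 = 24*r^4 + 128*r^3 + 296*r^2 + 320*r + 128 := rfl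
  have hA12 : ADJ 1 2 = -24*r^4 - 32*r^3 + 72*r^2 + 96*r := rfl
  have hA13 : ADJ 1 3 = 12*r^5 + 52*r^4 + 96*r^3 + 64*r^2 := rfl
  have hA20 : ADJ 2 0 = 36*r^5 + 60*r^4 + 16*r^3 := rfl
  have hA21 : ADJ 2 1 = -24*r^4 - 32*r^3 + 72*r^2 + 96*r := rfl
  have hA22 : ADJ 2 2 = 24*r^4 - 64*r^3 - 24*r^2 := rfl
  have hA23 : ADJ 2 3 = -12*r^5 - 12*r^4 + 112*r^3 + 96*r^2 := rfl
  -- the cleared entries as linear forms in `ξ̂_k := a₁ k * Π_{m ≠ k} a₀ m`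
  have Z : ∀ l : Fin 4, P₁₁ 3 l * dt * a₀ 3 * a₀ l -
      ∑ m : Fin 4, (ADJ 0 m + r * ADJ 1 m + (r + 1) * ADJ 2 m) * a₀ m * a₀ l * P₀₁ m l = 0 := by
    intro l; rw [← step l, E l, zero_mul]
  have Z1 := Z 1; have Z2 := Z 2; have Z3 := Z 3
  simp only [Fin.sum_univ_four, hP11, hA00, hA01, hA02, hA03, hA10, hA11, hA12, hA13, hA20, hA21, hA22, hA23, hdt] at Z1 Z2 Z3
  rw [hP01] at Z1 Z2 Z3
  simp only [Matrix.of_apply, Matrix.cons_val', Matrix.cons_val_zero, Matrix.cons_val_one,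
    Matrix.cons_val_two, Matrix.cons_val_three,
    Matrix.empty_val', Matrix.cons_val_fin_one, Matrix.vecHead, Matrix.vecTail,
    Function.comp_apply, Fin.succ_zero_eq_one, Fin.succ_one_eq_two] at Z1 Z2 Z3
  -- ξ̂-coordinates
  set x0 : K := a₁ 0 * (a₀ 1 * a₀ 2 * a₀ 3) with hx0
  set x1 : K := a₁ 1 * (a₀ 0 * a₀ 2 * a₀ 3) with hx1
  set x2 : K := a₁ 2 * (a₀ 0 * a₀ 1 * a₀ 3) with hx2
  set x3 : K := a₁ 3 * (a₀ 0 * a₀ 1 * a₀ 2) with hx3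
  -- A = (r-3)(r+1), B = r^2 - 3, C = 2r ; κ = 12 r^3 (3r+4)^2
  have κ0 : (12 : K) * r ^ 3 * (3 * r + 4) ^ 2 ≠ 0 :=
    mul_ne_zero (mul_ne_zero (by norm_num) (pow_ne_zero 3 hr)) (pow_ne_zero 2 h34)
  have R1 : -((r - 3) * (r + 1)) * x0 - (2 * r) * x2 + (r ^ 2 - 3) * x3 = 0 := by
    have : (12 : K) * r ^ 3 * (3 * r + 4) ^ 2 *
        (-((r - 3) * (r + 1)) * x0 - (2 * r) * x2 + (r ^ 2 - 3) * x3) = 0 := by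
      rw [hx0, hx2, hx3]; linear_combination Z1
    exact (mul_eq_zero.1 this).resolve_left κ0
  have R2 : (r ^ 2 - 3) * x0 - (2 * r) * x1 - ((r - 3) * (r + 1)) * x3 = 0 := by
    have : (12 : K) * r ^ 3 * (3 * r + 4) ^ 2 *
        ((r ^ 2 - 3) * x0 - (2 * r) * x1 - ((r - 3) * (r + 1)) * x3) = 0 := by
      rw [hx0, hx1, hx3]; linear_combination Z2
    exact (mul_eq_zero.1 this).resolve_left κ0
  have R3 : -(2 * r) * x0 + (r ^ 2 - 3) * x1 - ((r - 3) * (r + 1)) * x2 = 0 := by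
    have : (12 : K) * r ^ 3 * (3 * r + 4) ^ 2 *
        (-(2 * r) * x0 + (r ^ 2 - 3) * x1 - ((r - 3) * (r + 1)) * x2) = 0 := by
      rw [hx0, hx1, hx2]; linear_combination Z3
    exact (mul_eq_zero.1 this).resolve_left κ0
  -- differences vanish
  have S1 : (r ^ 2 - 3) * (x3 - x0) - (2 * r) * (x2 - x0) = 0 := by linear_combination R1
  have S2 : (2 * r) * (x1 - x0) + ((r - 3) * (r + 1)) * (x3 - x0) = 0 := by linear_combination -R2
  have S3 : (r ^ 2 - 3) * (x1 - x0) - ((r - 3) * (r + 1)) * (x2 - x0) = 0 := by linear_combination R3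
  have hA : (r - 3) * (r + 1) ≠ 0 := mul_ne_zero h3 h1
  have hB : r ^ 2 - 3 ≠ 0 := hsq3
  have hC : 2 * r ≠ 0 := mul_ne_zero two_ne_zero hr
  have T2 : 2 * ((r - 3) * (r + 1)) * (2 * r) * (x2 - x0) = 0 := by
    linear_combination (-((r - 3) * (r + 1))) * S1 + (r ^ 2 - 3) * S2 + (-(2 * r)) * S3
  have d2 : x2 - x0 = 0 :=
    (mul_eq_zero.1 T2).resolve_left (mul_ne_zero (mul_ne_zero two_ne_zero hA) hC)
  have d1 : x1 - x0 = 0 := by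
    have : (r ^ 2 - 3) * (x1 - x0) = 0 := by linear_combination S3 + ((r - 3) * (r + 1)) * d2
    exact (mul_eq_zero.1 this).resolve_left hB
  have d3 : x3 - x0 = 0 := by
    have : (r ^ 2 - 3) * (x3 - x0) = 0 := by linear_combination S1 + (2 * r) * d2
    exact (mul_eq_zero.1 this).resolve_left hB
  rw [hx0, hx1] at d1; rw [hx0, hx2] at d2; rw [hx0, hx3] at d3
  have p1 : a₁ 1 * a₀ 0 = a₁ 0 * a₀ 1 := by
    have : a₀ 2 * a₀ 3 * (a₁ 1 * a₀ 0 - a₁ 0 * a₀ 1) = 0 := by linear_combination d1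
    have := (mul_eq_zero.1 this).resolve_left (mul_ne_zero ha2 ha3)
    linear_combination this
  have p2 : a₁ 2 * a₀ 0 = a₁ 0 * a₀ 2 := by
    have : a₀ 1 * a₀ 3 * (a₁ 2 * a₀ 0 - a₁ 0 * a₀ 2) = 0 := by linear_combination d2
    have := (mul_eq_zero.1 this).resolve_left (mul_ne_zero ha1 ha3)
    linear_combination this
  have p3 : a₁ 3 * a₀ 0 = a₁ 0 * a₀ 3 := by
    have : a₀ 1 * a₀ 2 * (a₁ 3 * a₀ 0 - a₁ 0 * a₀ 3) = 0 := by linear_combination d3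
    have := (mul_eq_zero.1 this).resolve_left (mul_ne_zero ha1 ha2)
    linear_combination this
  exact hind (a₁ 0 / a₀ 0) (smul_of_ratios a₀ a₁ ha0 p1 p2 p3)

/-- ★ **The S2 chart**: frames from the chord pencil for `a₁ ∉ K a₀`. [folklore] -/
theorem frames_of_chordA_of_indep [CharZero K] (Ψ : Matrix (Fin 4) (Fin 4) K)
    (a₀ a₁ : Fin 4 → K) (r : K) (ha : ∀ k, a₀ k ≠ 0) (hind : ∀ μ : K, a₁ ≠ μ • a₀)
    (hr : r ≠ 0) (h1 : r + 1 ≠ 0) (h34 : 3 * r + 4 ≠ 0)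
    (hcub : r ^ 3 - 8 * r ^ 2 - 20 * r - 12 ≠ 0) (hq1 : r ^ 2 + 4 * r + 1 ≠ 0)
    (hq2 : 4 * r ^ 2 + 7 * r + 4 ≠ 0) (hq3 : r ^ 2 + r + 1 ≠ 0)
    (hquart : r ^ 4 - 7 * r ^ 3 - 15 * r ^ 2 - 7 * r + 1 ≠ 0) (h3 : r - 3 ≠ 0)
    (hsq3 : r ^ 2 - 3 ≠ 0)
    (hψ₀₀ : a₀ ⬝ᵥ Ψ *ᵥ (fun k => a₀ k * (![3*r^2 + 4*r, 3*r + 4, -3*r, r^2] : Fin 4 → K) k) = 0)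
    (hψ₀₁ : a₀ ⬝ᵥ Ψ *ᵥ (fun k => a₀ k * (![r, 1, 0, -r - 1] : Fin 4 → K) k) = 0)
    (hψ₁₀ : a₁ ⬝ᵥ Ψ *ᵥ (fun k => a₀ k * (![3*r^2 + 4*r, 3*r + 4, -3*r, r^2] : Fin 4 → K) k) = 0)
    (hψ₁₁ : a₁ ⬝ᵥ Ψ *ᵥ (fun k => a₀ k * (![r, 1, 0, -r - 1] : Fin 4 → K) k) = 0) :
    ∃ (a₀ a₁ y₀ y₁ : Fin 4 → K) (P₀₀ P₁₀ P₀₁ P₁₁ W₀ : Matrix (Fin 4) (Fin 4) K)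
        (v : Fin 4 → Fin 4 → K) (s : Fin 4 → K) (W : Matrix (Fin 4) (Fin 4) K),
        a₀ ⬝ᵥ Ψ *ᵥ y₀ = 0 ∧ a₀ ⬝ᵥ Ψ *ᵥ y₁ = 0 ∧ a₁ ⬝ᵥ Ψ *ᵥ y₀ = 0 ∧ a₁ ⬝ᵥ Ψ *ᵥ y₁ = 0 ∧
        (∀ b l, P₀₀ b l = (Matrix.of ![a₀, Pi.single b 1, y₀, Pi.single l 1]).permanent) ∧
        (∀ b l, P₁₀ b l = (Matrix.of ![a₀, Pi.single b 1, y₁, Pi.single l 1]).permanent) ∧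
        (∀ b l, P₀₁ b l = (Matrix.of ![a₁, Pi.single b 1, y₀, Pi.single l 1]).permanent) ∧
        (∀ b l, P₁₁ b l = (Matrix.of ![a₁, Pi.single b 1, y₁, Pi.single l 1]).permanent) ∧
        W₀ * P₀₀ = 1 ∧ (∀ j, P₁₀ *ᵥ v j = s j • P₀₀ *ᵥ v j) ∧ (∀ i j, i ≠ j → s i ≠ s j) ∧
        W * Matrix.of v = 1 ∧ P₁₁ - P₁₀ * W₀ * P₀₁ ≠ 0 :=
  frames_of_chordA Ψ a₀ a₁ r ha hr h1 h34 hcub hq1 hq2 hq3 hquart hψ₀₀ hψ₀₁ hψ₁₀ hψ₁₁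
    (chordA_Q_ne_zero a₀ a₁ ha hind r hr h1 h34 hcub h3 hsq3)

end Summit.ValiantsHypothesis.ValiantsHypothesis.Theorems.SymPencilPerFourPeeledTwoPencilChordAQ

end
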